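import Summits.QuantumFields.BalabanUV.Beta.ResolventLeafRecord
import Summits.QuantumFields.BalabanUV.Beta.ResolventBoxCertificateTaylor

/-!
# Beta / ResolventResidualLeafRecord — THE hG-FREE BOX LEAF AS A KERNEL OBJECT: «two sups + nothing» — the numeric content of
# `ResolventBoxCertificateTaylor.box_certificate_of_residual` as a record over `ℚ` with a DECIDABLE validity predicate, `certifies`,
# `hcert` from residual records, and route A's anchor over (schedule, residual records)
# (β sub-cell, BINDER-OWNERS row CAP-k, lineage `b2b-balaban-beta-an5`, gen 26; node BETA-an5-g26-SCHEDULES, leaf 9; journal l.18925 ∕ l.19031)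

`ResolventLeafRecord.BlockLeafRecord` (p228449) types the L-CF block leaf: per box «four sups + hG», `hG` being the E1′∕O4′ closed form of
`k₀⁻¹` (cap3 (ii) EXPORT, outside the kernel).  cap4-g18's engine D (journal l.18925, «CAP4-G18-DLEAF») certifies the SAME predicate
WITHOUT any closed form, through the residual socket `box_certificate_of_residual` (p221422) with `A = k` itself: per box a preconditioner
family `P`, the residual sup `θ ≥ sup ‖1 − P·A‖`, the norm sup `p ≥ sup ‖P‖`, and `p∕(1−θ) ≤ B` — «the residual analogue of
`BlockLeafRecord` has fields (cRe, cIm, h, θ, p, B) over ℚ, `Valid := θ < 1 ∧ 0 ≤ p ∧ p∕(1−θ) ≤ B` (decidable), `certifies` := Valid + the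
TWO sups ⟹ the leaf … two sups + NOTHING in place of four sups + hG» (cap4-g18, verbatim).  THIS LEAF types it:

* §1 **`ResidualLeafRecord d`** — `(cRe, cIm, h, θ, p, B)` over `ℚ`; `box`; **`Valid`** = `0 ≤ p ∧ θ < 1 ∧ p ≤ B·(1 − θ)` (division-free
  form of `p∕(1−θ) ≤ B`), DECIDABLE (`decide +kernel` ∕ `norm_num`); **`certifies`** (Valid + `hres` + `hP` ⟹ `IsUnit (A q).det ∧ ‖(A q)⁻¹‖ ≤ B` on the box),
  `certifies_le`;
* §2 **`hcert_of_residualRecords`** — one residual record per box of a list ⟹ the binder `hcert` of every route-A anchor, with NO `hG`;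
* §3 **`rowsOfOneLoopFormCode16E_routeA₂_ofResidualRecords`** — the two-term typed target over (rational-root schedule, residual records,
  fin schedules): the (Z2a)+(F) side is schedule DATA + residual-record DATA + per leaf the decidable validity, box inclusion and the TWO
  SUPS — nothing else; `_k₀ = 0`.  (The word-sum ∕ paired-ball twins take `hcert_of_residualRecords` through `CapRouteAWordsRecords` ∕
  `CapRouteARealBall` at the `…_ofFinRects` level — no further anchor is needed.)

PRICE HONESTY (cap4-g18, quoted): engine D direct is ≈ 36× dearer per volume than the closed-form engines and is NOT a campaign engine; its
role is independent hG-free confirmation of individual leaves (worst corner: `B_cover = 414.83 ≤ 780`, three engines on one predicate).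

HONEST FRAMING.  Kernel glue ([folklore]); no record for the cell's `k₀` supplied (the `example` is on illustrative rationals); 0 binders
instantiated; 0 certified coefficients; row 11 = 0∕2 (R87-b).  Discharging `BetaPertH` would make Bałaban's ultraviolet stability
unconditional — NOT the continuum limit, NOT the Clay problem.  HONEST DEPENDENCY: continuum YM on T⁴ ⇐ BetaPertH ∧ nine spine estimates (0/9 proved); BetaPertH ⇐ (D1) ∧ (D4) ∧ CAP+tail; G-an2-4 gates asym, D1 and NE2/3/4.
v1.0.1 (DOCFIX): docstrings only; declarations byte-identical.  0 `sorry`, 0 cite tags.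
-/

namespace Summit.QuantumFields.BalabanUV.Beta.ResolventResidualLeafRecord

open Complex Set Matrix
open Literature.MathematicalPhysics.QuantumFieldTheory.Balaban1983to89
open B4Strip (Strip)
open B4ContourShift (latticeKernel)
open B4TorusKernel (descend gridPt)
open Beta.AliasingTailL1 (aliasRatioL1)
open Beta.AliasingTailLattice (codeTheta code16SetE)
open Summit.QuantumFields.BalabanUV.Beta.CapRows (Rows)
open Summit.QuantumFields.BalabanUV.Beta.TubeMaximumModulus
open Summit.QuantumFields.BalabanUV.Beta.VertexToriSymmetry
open Summit.QuantumFields.BalabanUV.Beta.ConjReflectionAlgebra (MatConjSymm)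
open Summit.QuantumFields.BalabanUV.Beta.ResolventBoxCertificate (Box box_certificate_of_residual)
open Summit.QuantumFields.BalabanUV.Beta.CoverSchedules
open Summit.QuantumFields.BalabanUV.Beta.ResolventLeafRecord (quarterBoxesQ hcov_of_schedulesQ rowsOfOneLoopFormCode16E_routeA₂_ofSchedulesQ)
open scoped Real Matrix.Norms.L2Operator

noncomputable section

variable {d : ℕ}

/-! ## §1 The residual-leaf record over `ℚ` -/

/-- **THE RESIDUAL-LEAF RECORD** (engine D's hG-free leaf, cap4-g18 l.18925 ∕ `box_certificate_of_residual`'s numeric content): a box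
`(cRe, cIm, h)`, the residual sup `θ`, the preconditioner-norm sup `p`, the budget `B` — exact rationals. [folklore] -/
structure ResidualLeafRecord (d : ℕ) where
  /-- real parts of the box centre. -/
  cRe : Fin (d + 1) → ℚ
  /-- imaginary parts of the box centre (the sign-class torus). -/
  cIm : Fin (d + 1) → ℚ
  /-- half-widths of the box. -/
  h : Fin (d + 1) → ℚ
  /-- `θ ≥ sup_box ‖1 − P q · A q‖`. -/
  θ : ℚ
  /-- `p ≥ sup_box ‖P q‖`. -/
  p : ℚ
  /-- the budget: the record claims `‖(A q)⁻¹‖ ≤ B` on the box. -/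
  B : ℚ

namespace ResidualLeafRecord

variable (r : ResidualLeafRecord d)

/-- the complex box centre. [folklore] -/
def ctr : Fin (d + 1) → ℂ := fun μ => (((r.cRe μ : ℚ) : ℝ) : ℂ) + (((r.cIm μ : ℚ) : ℝ) : ℂ) * I
/-- the real half-widths. [folklore] -/
def hw : Fin (d + 1) → ℝ := fun μ => ((r.h μ : ℚ) : ℝ)
/-- the record's box. [folklore] -/
def box : Set (Fin (d + 1) → ℂ) := Box r.ctr r.hw

/-- **VALIDITY** = `0 ≤ p ∧ θ < 1 ∧ p ≤ B·(1 − θ)` — the division-free form of `p∕(1−θ) ≤ B`; exact rationals. [folklore] -/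
def Valid : Prop := 0 ≤ r.p ∧ r.θ < 1 ∧ r.p ≤ r.B * (1 - r.θ)

/-- validity is DECIDABLE (`decide +kernel` ∕ `norm_num`; plain `decide` does not reduce `Rat` arithmetic). [folklore] -/
instance decidableValid : Decidable r.Valid := by unfold Valid; infer_instance

variable {n : Type*} [Fintype n] [DecidableEq n]

/-- **A VALID RESIDUAL RECORD CERTIFIES ITS BOX — NO CLOSED FORM**: validity + the residual sup `hres` + the norm sup `hP` ⟹ `A q` invertible
and `‖(A q)⁻¹‖ ≤ B` on the whole box. [folklore] -/
theorem certifies (hv : r.Valid) {A P : (Fin (d + 1) → ℂ) → Matrix n n ℂ}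
    (hres : ∀ q ∈ r.box, ‖1 - P q * A q‖ ≤ r.θ) (hP : ∀ q ∈ r.box, ‖P q‖ ≤ r.p) :
    ∀ q ∈ r.box, IsUnit (A q).det ∧ ‖(A q)⁻¹‖ ≤ r.B := by
  obtain ⟨_, hθ1, hpB⟩ := hv
  have hθ1' : (r.θ : ℝ) < 1 := by exact_mod_cast hθ1
  have hB : (r.p : ℝ) / (1 - r.θ) ≤ r.B := by
    rw [div_le_iff₀ (by linarith)]
    exact_mod_cast hpB
  exact box_certificate_of_residual hres hθ1' hP hB

/-- with a uniform budget. [folklore] -/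
theorem certifies_le (hv : r.Valid) {Ba : ℝ} (hBa : (r.B : ℝ) ≤ Ba) {A P : (Fin (d + 1) → ℂ) → Matrix n n ℂ}
    (hres : ∀ q ∈ r.box, ‖1 - P q * A q‖ ≤ r.θ) (hP : ∀ q ∈ r.box, ‖P q‖ ≤ r.p) :
    ∀ q ∈ r.box, IsUnit (A q).det ∧ ‖(A q)⁻¹‖ ≤ Ba := fun q hq =>
  let h := r.certifies hv hres hP q hq
  ⟨h.1, h.2.trans hBa⟩

end ResidualLeafRecord

/-- ARITHMETIC DEMO (illustrative rationals of the SIZE cap4-g18 displays — `θ ≈ 7·10⁻³`, `p ≈ 412`, `B = 415` — NOT the record's exact values,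
NOT a certificate): the kernel DECIDES validity. [folklore] -/
example : (⟨fun _ => 3217 / 1024, fun _ => 9 / 10, fun _ => 1 / 16, 7 / 1000, 412, 415⟩ : ResidualLeafRecord 3).Valid := by
  unfold ResidualLeafRecord.Valid; norm_num

/-- … and refutes it at `B = 414` (`412 ≤ 414·0.993 = 411.1` fails). [folklore] -/
example : ¬ (⟨fun _ => 3217 / 1024, fun _ => 9 / 10, fun _ => 1 / 16, 7 / 1000, 412, 414⟩ : ResidualLeafRecord 3).Valid := by
  unfold ResidualLeafRecord.Valid; norm_num

/-! ## §2 `hcert` from residual records — two sups per leaf, no `hG` -/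

section Records

variable {n : Type*} [Fintype n] [DecidableEq n]

/-- **`hcert` FROM RESIDUAL RECORDS**: one record per box of a list, each valid with budget `≤ Ba`, each box inside its record's box, and per
record a preconditioner family with the TWO sups ⟹ the binder `hcert` of every route-A anchor — with NO closed-form hypothesis. [folklore] -/
theorem hcert_of_residualRecords {boxes : Finset ((Fin (d + 1) → ℂ) × (Fin (d + 1) → ℝ))}
    (rec : (Fin (d + 1) → ℂ) × (Fin (d + 1) → ℝ) → ResidualLeafRecord d) {Ba : ℝ}
    (hvalid : ∀ bx ∈ boxes, (rec bx).Valid ∧ ((rec bx).B : ℝ) ≤ Ba)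
    (hsub : ∀ bx ∈ boxes, Box bx.1 bx.2 ⊆ (rec bx).box)
    {A : (Fin (d + 1) → ℂ) → Matrix n n ℂ} (P : (Fin (d + 1) → ℂ) × (Fin (d + 1) → ℝ) → (Fin (d + 1) → ℂ) → Matrix n n ℂ)
    (hres : ∀ bx ∈ boxes, ∀ q ∈ (rec bx).box, ‖1 - P bx q * A q‖ ≤ (rec bx).θ)
    (hP : ∀ bx ∈ boxes, ∀ q ∈ (rec bx).box, ‖P bx q‖ ≤ (rec bx).p) :
    ∀ bx ∈ boxes, ∀ q ∈ Box bx.1 bx.2, IsUnit (A q).det ∧ ‖(A q)⁻¹‖ ≤ Ba := fun bx hbx q hq =>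
  (rec bx).certifies_le (hvalid bx hbx).1 (hvalid bx hbx).2 (hres bx hbx) (hP bx hbx) q (hsub bx hbx hq)

end Records

/-! ## §3 Route A's anchor over (schedule, residual records) -/

section Anchor

variable {n : Type*} [Fintype n] [DecidableEq n]
variable {b : ℕ → ℝ} {A B C D : (Fin 4 → ℂ) → Matrix n n ℂ} {κ Ba Sst Ss St : ℝ} {c : Fin 4 → ℂ}

/-- **THE TYPED TARGET OVER (SCHEDULE, RESIDUAL RECORDS)** — hG-FREE: `ResolventLeafRecord.rowsOfOneLoopFormCode16E_routeA₂_ofSchedulesQ` with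
`hcert` from one `ResidualLeafRecord` per kernel leaf + per leaf a preconditioner family with the two sups. [folklore] -/
def rowsOfOneLoopFormCode16E_routeA₂_ofResidualRecords
    (hb : b 0 = (latticeKernel (fun p => ((A p)⁻¹ * B p).trace - ((A p)⁻¹ * C p * (A (p - c))⁻¹ * D p).trace) 0).re)
    (hκ : 0 < κ) (hc : ∀ μ, (c μ).im = 0)
    (hA : MatTubeHol A (fun _ => κ)) (hA' : MatTubeHol (fun p => A (p - c)) (fun _ => κ))
    (hBst : MatTubeHol B (fun _ => κ)) (hBs : MatTubeHol C (fun _ => κ)) (hBt : MatTubeHol D (fun _ => κ))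
    (hAn : MatNegTranspose A) (hAc : MatConjSymm A)
    {R : ℚ} (hR : π ≤ (R : ℝ)) (ν₀ ν₁ : Fin (3 + 1)) (S : (Fin (3 + 1) → Bool) → Sched 3)
    (rec : (Fin (3 + 1) → ℂ) × (Fin (3 + 1) → ℝ) → ResidualLeafRecord 3)
    (hvalid : ∀ bx ∈ quarterBoxesQ (fun _ : Fin (3 + 1) => κ) R ν₀ ν₁ S, (rec bx).Valid ∧ ((rec bx).B : ℝ) ≤ Ba)
    (hsub : ∀ bx ∈ quarterBoxesQ (fun _ : Fin (3 + 1) => κ) R ν₀ ν₁ S, Box bx.1 bx.2 ⊆ (rec bx).box)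
    (P : (Fin (3 + 1) → ℂ) × (Fin (3 + 1) → ℝ) → (Fin (3 + 1) → ℂ) → Matrix n n ℂ)
    (hres : ∀ bx ∈ quarterBoxesQ (fun _ : Fin (3 + 1) => κ) R ν₀ ν₁ S, ∀ q ∈ (rec bx).box, ‖1 - P bx q * A q‖ ≤ (rec bx).θ)
    (hP : ∀ bx ∈ quarterBoxesQ (fun _ : Fin (3 + 1) => κ) R ν₀ ν₁ S, ∀ q ∈ (rec bx).box, ‖P bx q‖ ≤ (rec bx).p)
    (hRfl : ∀ (ν : Fin (3 + 1)) (p : Fin (3 + 1) → ℂ), (A (reflectAt ν p)).det = (A p).det)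
    (F : Fin (3 + 1) → Sched 1)
    (hcertF : ∀ (i : Fin (3 + 1)), ∀ bx ∈ finRects (F i), ∀ τ x : ℝ, |τ - bx.1 0| ≤ bx.2 0 → |x - bx.1 1| ≤ bx.2 1 →
      IsUnit (A (i.insertNth ((x : ℂ) + ((τ * κ : ℝ) : ℂ) * I) fun _ => ((τ * κ : ℝ) : ℂ) * I)).det)
    (hSst : ∀ p ∈ VertexTori (fun _ : Fin (3 + 1) => κ), ‖B p‖ ≤ Sst)
    (hSs : ∀ p ∈ VertexTori (fun _ : Fin (3 + 1) => κ), ‖C p‖ ≤ Ss)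
    (hSt : ∀ p ∈ VertexTori (fun _ : Fin (3 + 1) => κ), ‖D p‖ ≤ St)
    {N : ℕ} (hN : 1 ≤ N) [NeZero (4 * N)] {t r : ℝ}
    (hT : ‖((code16SetE N).card : ℂ)⁻¹ *
        (∑ w ∈ code16SetE N, descend (fun p => ((A p)⁻¹ * B p).trace - ((A p)⁻¹ * C p * (A (p - c))⁻¹ * D p).trace)
          (gridPt (4 * N) w)) - t‖ ≤ r)
    {A₀ : ℝ} (hA₀ : Fintype.card n * (Ba * Sst + Ba * Ss * Ba * St) * codeTheta (aliasRatioL1 κ N) ≤ A₀) (lo : ℚ)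
    (hlo : ((lo : ℚ) : ℝ) ≤ t - r - A₀) : Rows b :=
  rowsOfOneLoopFormCode16E_routeA₂_ofSchedulesQ hb hκ hc hA hA' hBst hBs hBt hAn hAc hR ν₀ ν₁ S
    (hcert_of_residualRecords rec hvalid hsub P hres hP) hRfl F hcertF hSst hSs hSt hN hT hA₀ lo hlo

/-- its level is `k₀ = 0`. [folklore] -/
theorem rowsOfOneLoopFormCode16E_routeA₂_ofResidualRecords_k₀
    (hb : b 0 = (latticeKernel (fun p => ((A p)⁻¹ * B p).trace - ((A p)⁻¹ * C p * (A (p - c))⁻¹ * D p).trace) 0).re)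
    (hκ : 0 < κ) (hc : ∀ μ, (c μ).im = 0)
    (hA : MatTubeHol A (fun _ => κ)) (hA' : MatTubeHol (fun p => A (p - c)) (fun _ => κ))
    (hBst : MatTubeHol B (fun _ => κ)) (hBs : MatTubeHol C (fun _ => κ)) (hBt : MatTubeHol D (fun _ => κ))
    (hAn : MatNegTranspose A) (hAc : MatConjSymm A)
    {R : ℚ} (hR : π ≤ (R : ℝ)) (ν₀ ν₁ : Fin (3 + 1)) (S : (Fin (3 + 1) → Bool) → Sched 3)
    (rec : (Fin (3 + 1) → ℂ) × (Fin (3 + 1) → ℝ) → ResidualLeafRecord 3)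
    (hvalid : ∀ bx ∈ quarterBoxesQ (fun _ : Fin (3 + 1) => κ) R ν₀ ν₁ S, (rec bx).Valid ∧ ((rec bx).B : ℝ) ≤ Ba)
    (hsub : ∀ bx ∈ quarterBoxesQ (fun _ : Fin (3 + 1) => κ) R ν₀ ν₁ S, Box bx.1 bx.2 ⊆ (rec bx).box)
    (P : (Fin (3 + 1) → ℂ) × (Fin (3 + 1) → ℝ) → (Fin (3 + 1) → ℂ) → Matrix n n ℂ)
    (hres : ∀ bx ∈ quarterBoxesQ (fun _ : Fin (3 + 1) => κ) R ν₀ ν₁ S, ∀ q ∈ (rec bx).box, ‖1 - P bx q * A q‖ ≤ (rec bx).θ)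
    (hP : ∀ bx ∈ quarterBoxesQ (fun _ : Fin (3 + 1) => κ) R ν₀ ν₁ S, ∀ q ∈ (rec bx).box, ‖P bx q‖ ≤ (rec bx).p)
    (hRfl : ∀ (ν : Fin (3 + 1)) (p : Fin (3 + 1) → ℂ), (A (reflectAt ν p)).det = (A p).det)
    (F : Fin (3 + 1) → Sched 1)
    (hcertF : ∀ (i : Fin (3 + 1)), ∀ bx ∈ finRects (F i), ∀ τ x : ℝ, |τ - bx.1 0| ≤ bx.2 0 → |x - bx.1 1| ≤ bx.2 1 →
      IsUnit (A (i.insertNth ((x : ℂ) + ((τ * κ : ℝ) : ℂ) * I) fun _ => ((τ * κ : ℝ) : ℂ) * I)).det)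
    (hSst : ∀ p ∈ VertexTori (fun _ : Fin (3 + 1) => κ), ‖B p‖ ≤ Sst)
    (hSs : ∀ p ∈ VertexTori (fun _ : Fin (3 + 1) => κ), ‖C p‖ ≤ Ss)
    (hSt : ∀ p ∈ VertexTori (fun _ : Fin (3 + 1) => κ), ‖D p‖ ≤ St)
    {N : ℕ} (hN : 1 ≤ N) [NeZero (4 * N)] {t r : ℝ}
    (hT : ‖((code16SetE N).card : ℂ)⁻¹ *
        (∑ w ∈ code16SetE N, descend (fun p => ((A p)⁻¹ * B p).trace - ((A p)⁻¹ * C p * (A (p - c))⁻¹ * D p).trace)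
          (gridPt (4 * N) w)) - t‖ ≤ r)
    {A₀ : ℝ} (hA₀ : Fintype.card n * (Ba * Sst + Ba * Ss * Ba * St) * codeTheta (aliasRatioL1 κ N) ≤ A₀) (lo : ℚ)
    (hlo : ((lo : ℚ) : ℝ) ≤ t - r - A₀) :
    (rowsOfOneLoopFormCode16E_routeA₂_ofResidualRecords hb hκ hc hA hA' hBst hBs hBt hAn hAc hR ν₀ ν₁ S rec hvalid hsub P hres hP hRfl F
      hcertF hSst hSs hSt hN hT hA₀ lo hlo).k₀ = 0 := rfl

end Anchor

end

end Summit.QuantumFields.BalabanUV.Beta.ResolventResidualLeafRecord
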